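import Literature.Analysis.FluidPDE.MultiplierHeatKernelDecay
import Literature.Analysis.FluidPDE.ForwardHeatPotentials
import Literature.Analysis.FluidPDE.CKNEpsilonRegularity
import HarnessLib

/-!
# Jia–Šverák 2014, proof of Thm. 3.2: parabolic Hölder bounds for the heat potentials, with
  constants

Analysis/FluidPDE proofs file (theorems only, no new definitions, no new named facts), part of
the proof of the named fact `Literature.Analysis.FluidPDE.jia_sverak_2014_theorem_3_2`
(`JiaSverak2014LocalRegularity.lean`; H. Jia, V. Šverák, Invent. Math. 196 (2014) =
arXiv:1204.0529, §3 Thm. 3.2). The printed proof (arXiv p. 9, "by Lemma 2.1 we see `u₁` and `u₂`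
are Hölder continuous") needs the parabolic Hölder continuity of the Duhamel terms
`∫₀ᵗ e^{Δ(t-s)} F ds`, `∫₀ᵗ e^{Δ(t-s)} ∂ⱼg ds` of bounded (or `L^∞_t L^q_x`) data, *with constants
depending only on the size of the data*. The tree proves Lemarié-Rieusset's Prop. 13.4 (heat
potentials of parabolic-Morrey data are parabolic-Hölder, `prop13_4_holds`) with an existential
constant; its proofs (`LemarieRieusset2016.heatPotential_holder_of_morrey`,
`LemarieRieusset2016.prop13_4_multiplierPart_of_gaussian`) are however quantitative, the constant
being the explicit `kernelHolderConst(A, B, m, d)` / `kernelHolderConstFwd(A, B, m, d)` in the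
kernel constant `A` and the `L¹`-Morrey constant `B` of the datum. This file records these
quantitative forms and the `L¹`-Morrey constants of bounded data supported in a bounded set:

* `heatPotential_holder_of_morreyOne` — `W₊ ⊛ f` is `ParabolicHolderOnWith (kernelHolderConst A₁ B 3 d) (d-3)`
  for a measurable real `f` vanishing for `s ≤ 0` with `∫_{Q*_r} |f| ≤ B r^d`, `3 < d < 4`
  (`A₁` the heat-kernel constant);
* `exists_multiplierHeatPotential_holder_of_morreyOne` — for a direction `v` there is `A` with:
  `-Re σᵥ(D)W₊ ⊛ g` is `ParabolicHolderOnWith (kernelHolderConstFwd A B 4 d) (d-4)` for measurable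
  `g` vanishing for `s ≤ 0` with `∫_{Q*_r}|g| ≤ B r^d`, `4 < d < 5`;
* `morreyOne_of_bound` — a datum bounded by `N` and supported in a set of finite measure `V`
  has `∫_{Q*_r}|f| ≤ N (2|B₁| + V) r^d` for every `0 < d ≤ 5`.

## References

* H. Jia, V. Šverák, Invent. Math. 196 (2014) = arXiv:1204.0529, §2 Lemma 2.1, §3 proof of
  Thm. 3.2 (p. 9). Bib key `JiaSverak2014`.
* P. G. Lemarié-Rieusset, *The Navier–Stokes Problem in the 21st Century* (2016), Prop. 13.4
  p. 464. Bib key `LemarieRieusset2016`.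
-/

noncomputable section

open MeasureTheory TopologicalSpace Set Function Filter Metric
open _root_.Topology
open scoped ENNReal NNReal

namespace Literature.Analysis.FluidPDE

namespace JiaSverak2014

open LemarieRieusset2016

/-! ### The heat-kernel part, quantitative -/

/-- **Heat potentials of `L¹`-Morrey data are parabolic-Hölder, with constant** (the proof of the
tree's `LemarieRieusset2016.heatPotential_holder_of_morrey`, Lemarié-Rieusset 2016 Prop. 13.4
heat part, run with an explicit `L¹`-Morrey constant `B`): if `f : ℝ × ℝ³ → ℝ` is measurable,
vanishes for `s ≤ 0`, and `∫_{Q*_r(c)} |f| ≤ B r^d` for all cylinders (`0 ≤ B`, `3 < d < 4`),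
then `z ↦ heatPotential 1 f z` is `ParabolicHolderOnWith (kernelHolderConst A₁ B 3 d) (d - 3)` on
`ℝ × ℝ³`, `A₁ = max (gaussConst 1 3) (heatRegConst 1)`. [cite: LemarieRieusset2016, Prop. 13.4 p. 464] -/
theorem heatPotential_holder_of_morreyOne {f : ℝ × (EuclideanSpace ℝ (Fin 3)) → ℝ} (hf : Measurable f)
    {B d : ℝ} (hB : 0 ≤ B) (hd3 : 3 < d) (hd4 : d < 4)
    (hfT : ∀ w : ℝ × (EuclideanSpace ℝ (Fin 3)), w.1 ≤ 0 → f w = 0)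
    (hMor : ∀ (c : ℝ × (EuclideanSpace ℝ (Fin 3))) (r : ℝ), 0 < r →
      ∫⁻ w in FluidPDE.parabolicCylinderCentered r c, ‖f w‖ₑ ≤ ENNReal.ofReal (B * r ^ d)) :
    ParabolicHolderOnWith (kernelHolderConst (max (gaussConst 1 3) (heatRegConst 1)) B 3 d) (d - 3)
      (fun z => heatPotential 1 f z) univ := by
  have hν : (0 : ℝ) < 1 := one_pos
  set F : ℝ × (EuclideanSpace ℝ (Fin 3)) → ℂ := fun w => (f w : ℂ) with hF
  have hFm : Measurable F := Complex.measurable_ofReal.comp hf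
  have hFT : ∀ w : ℝ × (EuclideanSpace ℝ (Fin 3)), w.1 ≤ 0 → F w = 0 := fun w hw => by simp [hF, hfT w hw]
  have hMorF : ∀ (c : ℝ × (EuclideanSpace ℝ (Fin 3))) (r : ℝ), 0 < r →
      ∫⁻ w in FluidPDE.parabolicCylinderCentered r c, ‖F w‖ₑ ≤ ENNReal.ofReal (B * r ^ d) := by
    intro c r hr
    refine (lintegral_congr fun w => ?_).trans_le (hMor c r hr)
    rw [hF]
    simp only
    rw [← ofReal_norm, ← ofReal_norm, Complex.norm_real]
  -- the kernel
  set K : ℝ × (EuclideanSpace ℝ (Fin 3)) → ℂ := fun z => ((heatKernelFwd 1 z : ℝ) : ℂ) with hK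
  have hKm : Measurable K := Complex.measurable_ofReal.comp (measurable_heatKernelFwd 1)
  have hK0 : K 0 = 0 := by simp [hK, heatKernelFwd_zero]
  set A : ℝ := max (gaussConst 1 3) (heatRegConst 1) with hA
  have hK1 : ∀ z, ‖K z‖ * parabolicNorm z ^ (3 : ℝ) ≤ A := fun z =>
    (heatKernelFwd_mul_parabolicNorm_pow_le hν z).trans (le_max_left _ _)
  have hK2 : ∀ z z' : ℝ × (EuclideanSpace ℝ (Fin 3)), 2 * parabolicNorm z' ≤ parabolicNorm z →
      ‖K z - K (z - z')‖ * parabolicNorm z ^ ((3 : ℝ) + 1) ≤ A * parabolicNorm z' := fun z z' h =>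
    (heatKernelFwd_sub_mul_parabolicNorm_pow_le hν z z' h).trans
      (mul_le_mul_of_nonneg_right (le_max_right _ _) (parabolicNorm_nonneg _))
  have hint : ∀ z, Integrable (fun w => K (z - w) * F w) := fun z =>
    integrable_heatKernelFwd_mul hν hFm hB hd3 (by linarith) hFT hMorF z
  have H := parabolicHolderOnWith_integral_of_kernel_bounds hKm hFm hB (by norm_num : (0 : ℝ) < 3)
    hd3 (by linarith) hK0 hK1 hK2 hMorF hint
  -- back to the real potential
  have hfun : ∀ z, (∫ w, K (z - w) * F w) = ((heatPotential 1 f z : ℝ) : ℂ) := fun z => by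
    rw [← heatPotential_ofReal 1 f z]
    exact (heatPotential_eq_integral_mul 1 F z).symm
  intro z₁ _ z₂ _
  have h := H z₁ (mem_univ _) z₂ (mem_univ _)
  simp only [hfun] at h
  rwa [← Complex.ofReal_sub, Complex.norm_real, Real.norm_eq_abs, ← Real.norm_eq_abs] at h

/-! ### The multiplier part, quantitative -/

/-- **Gradient multiplier potentials of `L¹`-Morrey data are parabolic-Hölder, with constant**
(the proof of the tree's `LemarieRieusset2016.prop13_4_multiplierPart_of_gaussian` with the symbol
`σᵥ = 2πi⟪ξ, v⟫` of `∂ᵥ`, run with an explicit `L¹`-Morrey constant): for every direction `v` there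
is `A = A(v)` (the kernel constant of `σᵥ(D)W₊`) such that, for every measurable
`g : ℝ × ℝ³ → ℝ` vanishing for `s ≤ 0` with `∫_{Q*_r(c)} |g| ≤ B r^d` (`0 ≤ B`, `4 < d < 5`),
`z ↦ -Re (σᵥ(D)W₊ ⊛ g)(z)` is `ParabolicHolderOnWith (kernelHolderConstFwd A B 4 d) (d - 4)` on
`ℝ × ℝ³`. [cite: LemarieRieusset2016, Prop. 13.4 p. 464] -/
theorem exists_multiplierHeatPotential_holder_of_morreyOne (v : EuclideanSpace ℝ (Fin 3)) :
    ∃ A : ℝ, ∀ {g : ℝ × (EuclideanSpace ℝ (Fin 3)) → ℝ}, Measurable g →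
      ∀ {B d : ℝ}, 0 ≤ B → 4 < d → d < 5 →
      (∀ w : ℝ × (EuclideanSpace ℝ (Fin 3)), w.1 ≤ 0 → g w = 0) →
      (∀ (c : ℝ × (EuclideanSpace ℝ (Fin 3))) (r : ℝ), 0 < r →
        ∫⁻ w in FluidPDE.parabolicCylinderCentered r c, ‖g w‖ₑ ≤ ENNReal.ofReal (B * r ^ d)) →
      ParabolicHolderOnWith (kernelHolderConstFwd A B 4 d) (d - 4)
        (fun z => -(multiplierHeatPotential 1 (derivSymbol v) g z).re) univ := by
  have hν : (0 : ℝ) < 1 := one_pos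
  obtain ⟨hKmeas, A, hK1, hK2⟩ := multiplierHeatKernelFwd_estimates gaussianMultiplierKernel_estimates_holds hν
    (contDiffOn_derivSymbol v) (fun t ht ξ => derivSymbol_smul v t ht ξ)
  refine ⟨A, ?_⟩
  intro g hg B d hB hd4 hd5 hgT hMor
  set G : ℝ × (EuclideanSpace ℝ (Fin 3)) → ℂ := fun w => (g w : ℂ) with hG
  have hGm : Measurable G := Complex.measurable_ofReal.comp hg
  have hGT : ∀ w : ℝ × (EuclideanSpace ℝ (Fin 3)), w.1 ≤ 0 → G w = 0 := fun w hw => by simp [hG, hgT w hw]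
  have hMorG : ∀ (c : ℝ × (EuclideanSpace ℝ (Fin 3))) (r : ℝ), 0 < r →
      ∫⁻ w in FluidPDE.parabolicCylinderCentered r c, ‖G w‖ₑ ≤ ENNReal.ofReal (B * r ^ d) := by
    intro c r hr
    refine (lintegral_congr fun w => ?_).trans_le (hMor c r hr)
    rw [hG]
    simp only
    rw [← ofReal_norm, ← ofReal_norm, Complex.norm_real]
  have hK0 : ∀ z : ℝ × (EuclideanSpace ℝ (Fin 3)), z.1 ≤ 0 → multiplierHeatKernelFwd 1 (derivSymbol v) z = 0 :=
    fun z hz => multiplierHeatKernelFwd_of_nonpos 1 (derivSymbol v) hz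
  have hint : ∀ z, Integrable (fun w => multiplierHeatKernelFwd 1 (derivSymbol v) (z - w) * G w) := fun z =>
    integrable_kernel_mul_of_morrey_fwd hKmeas hGm hB (by norm_num : (3 : ℝ) < 4) hd4 hK0 hK1 hGT hMorG z
  have H := parabolicHolderOnWith_integral_of_kernel_bounds_fwd hKmeas hGm hB
    (by norm_num : (3 : ℝ) < 4) hd4 (by linarith) hK0 hK1 hK2 hMorG hint
  have hfun : (fun z => ∫ w, multiplierHeatKernelFwd 1 (derivSymbol v) (z - w) * G w) =
      multiplierHeatPotential 1 (derivSymbol v) g := by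
    funext z; rfl
  rw [hfun] at H
  exact H.re.neg

/-! ### `L¹`-Morrey constants of bounded data -/

/-- **`L¹`-Morrey bound of bounded data with support of finite measure**: if `‖f‖ ≤ N` a.e. and
`f` vanishes a.e. off a measurable set `E` of finite volume `V`, then for every `0 < d ≤ 5` and
every cylinder, `∫_{Q*_r(c)} |f| ≤ N (2|B₁| + V) r^d` (for `r ≤ 1` by `|Q*_r| = 2|B₁|r⁵ ≤ 2|B₁|r^d`,
for `r ≥ 1` by `N·V ≤ N V r^d`). [folklore] -/
theorem morreyOne_of_bound {f : ℝ × (EuclideanSpace ℝ (Fin 3)) → ℝ} {N : ℝ} (hN : 0 ≤ N)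
    (hfN : ∀ᵐ w ∂(volume : Measure (ℝ × EuclideanSpace ℝ (Fin 3))), ‖f w‖ ≤ N)
    {E : Set (ℝ × EuclideanSpace ℝ (Fin 3))} (hE : MeasurableSet E) (hEfin : volume E ≠ ⊤)
    (hfE : ∀ᵐ w ∂(volume : Measure (ℝ × EuclideanSpace ℝ (Fin 3))), w ∉ E → f w = 0)
    {d : ℝ} (hd0 : 0 < d) (hd5 : d ≤ 5) (c : ℝ × EuclideanSpace ℝ (Fin 3)) {r : ℝ} (hr : 0 < r) :
    ∫⁻ w in FluidPDE.parabolicCylinderCentered r c, ‖f w‖ₑ ≤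
      ENNReal.ofReal (N * (2 * (volume (ball (0 : EuclideanSpace ℝ (Fin 3)) 1)).toReal + (volume E).toReal) * r ^ d) := by
  set Q : Set (ℝ × EuclideanSpace ℝ (Fin 3)) := FluidPDE.parabolicCylinderCentered r c with hQ
  have hQm : MeasurableSet Q := measurableSet_Ioo.prod measurableSet_ball
  set V₁ : ℝ≥0∞ := volume (ball (0 : EuclideanSpace ℝ (Fin 3)) 1) with hV₁
  have hV₁t : V₁ ≠ ⊤ := measure_ball_lt_top.ne
  -- `∫_Q |f| ≤ N · vol(Q ∩ E)`
  have h1 : ∫⁻ w in Q, ‖f w‖ₑ ≤ ENNReal.ofReal N * volume (Q ∩ E) := by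
    have hae : ∀ᵐ w ∂(volume.restrict Q), ‖f w‖ₑ ≤ (E.indicator (fun _ => ENNReal.ofReal N) w) := by
      filter_upwards [ae_restrict_of_ae hfN, ae_restrict_of_ae hfE] with w hwN hwE
      by_cases hw : w ∈ E
      · rw [indicator_of_mem hw, ← ofReal_norm]; exact ENNReal.ofReal_le_ofReal hwN
      · rw [indicator_of_notMem hw, hwE hw, enorm_zero]
    calc ∫⁻ w in Q, ‖f w‖ₑ ≤ ∫⁻ w in Q, E.indicator (fun _ => ENNReal.ofReal N) w := lintegral_mono_ae hae
      _ = ENNReal.ofReal N * volume (Q ∩ E) := by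
          rw [lintegral_indicator hE, setLIntegral_const, Measure.restrict_apply hE, inter_comm]
  refine h1.trans ?_
  have hvolQ : volume Q = ENNReal.ofReal (2 * r ^ 5) * V₁ := volume_parabolicCylinderCentered hr c
  by_cases hr1 : r ≤ 1
  · -- small cylinders: bound by the volume of `Q`
    have h2 : volume (Q ∩ E) ≤ ENNReal.ofReal (2 * r ^ 5) * V₁ := (measure_mono inter_subset_left).trans (le_of_eq hvolQ)
    have hr5 : r ^ 5 ≤ r ^ d := by
      rw [← Real.rpow_natCast]
      exact Real.rpow_le_rpow_of_exponent_ge hr hr1 (by exact_mod_cast hd5)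
    calc ENNReal.ofReal N * volume (Q ∩ E) ≤ ENNReal.ofReal N * (ENNReal.ofReal (2 * r ^ 5) * V₁) := mul_le_mul' le_rfl h2
      _ = ENNReal.ofReal (N * (2 * V₁.toReal) * r ^ 5) := by
          have e : V₁ = ENNReal.ofReal V₁.toReal := (ENNReal.ofReal_toReal hV₁t).symm
          conv_lhs => rw [e]
          rw [← ENNReal.ofReal_mul (by positivity), ← ENNReal.ofReal_mul hN]
          congr 1; ring
      _ ≤ _ := by
          refine ENNReal.ofReal_le_ofReal ?_
          have hVE : 0 ≤ (volume E).toReal := ENNReal.toReal_nonneg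
          have hV0 : 0 ≤ V₁.toReal := ENNReal.toReal_nonneg
          calc N * (2 * V₁.toReal) * r ^ 5 ≤ N * (2 * V₁.toReal) * r ^ d := by gcongr
            _ ≤ N * (2 * V₁.toReal + (volume E).toReal) * r ^ d := by gcongr; linarith
  · -- large cylinders: bound by the volume of `E`
    have hr1' : 1 ≤ r := (not_le.1 hr1).le
    have h2 : volume (Q ∩ E) ≤ volume E := measure_mono inter_subset_right
    have hrd : 1 ≤ r ^ d := Real.one_le_rpow hr1' hd0.le
    calc ENNReal.ofReal N * volume (Q ∩ E) ≤ ENNReal.ofReal N * volume E := mul_le_mul' le_rfl h2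
      _ = ENNReal.ofReal (N * (volume E).toReal) := by
          rw [← ENNReal.ofReal_toReal hEfin, ← ENNReal.ofReal_mul hN, ENNReal.ofReal_toReal hEfin]
      _ ≤ _ := by
          refine ENNReal.ofReal_le_ofReal ?_
          have hVE : 0 ≤ (volume E).toReal := ENNReal.toReal_nonneg
          have hV0 : 0 ≤ V₁.toReal := ENNReal.toReal_nonneg
          calc N * (volume E).toReal = N * (volume E).toReal * 1 := by ring
            _ ≤ N * (2 * V₁.toReal + (volume E).toReal) * r ^ d := by gcongr; linarith

end JiaSverak2014

end Literature.Analysis.FluidPDE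

end
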